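import Summits.QuantumFields.YangMills.Theorems.UnitScaleTiltProp7MassiveSolutionGradientSupAllMembers
import Summits.QuantumFields.YangMills.Theorems.UnitScaleTiltProp7OneFormGradientSupNabla
import HarnessLib

/-!
# Route `UnitScaleTilt`, crux K1 «MinimiserStabilityRegPr» (stmt-QuantumFields-19200), EX one-form storey — **(R4) THE ONE-FORM GRADIENT SUP (OF-GRAD) AND ITS (∇) LETTERS AT EVERY
# MEMBER**: px5 g13 ✓`Prop7OneFormGradientSup` §1–§3 and ✓`Prop7OneFormGradientSupNabla` §2 re-run VERBATIM with the no-wrap antecedent `hroom : 2(12·L^{K−n} + 5) ≤ sitesPerDir 0`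
# DELETED and ONE supplier token swapped (px19 T1-core ✓`norm_equiv_DL2_le_of_sup` ↦ (R3) ✓`norm_equiv_DL2_le_of_sup_allMembers`, the T1 row read on the `L³`-fold cover, SAME
# constant).  After this file the (∇)-half letters consumed by px17 ✓`Prop7GaugeModeHessianRow`∕(H∇) ✓`Prop7ChainPotentialHessianRow` and px21 (∇0) ✓`Prop7OneFormGreenBlockGradient{,KFree,Family}`
# have room-free suppliers; their own roomless editions are the same one-token re-runs (their lineages' pens).  (Width seat `ym3-torus-px5` gen 15; generated from the TREE by `gen_r4.py`.)

Cell `ym3-torus` (HUMAN RULING D-0037; rung R3 = SU(2) YM₃ on T³ — NOT d = 4, NOT infinite volume, NOT a mass gap, NOT Clay).  THEOREMS ONLY (0 `def`, 0 `sorry`, default heartbeats);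
`--supports stmt-QuantumFields-19200 --as helper`; count-neutral.

WHAT IS PROVED (ns `Summit.QuantumFields.YangMills.Theorems.Prop7OneFormGradientSupAllMembers`; statements = the tree's with `hroom` deleted, binders otherwise IDENTICAL and in the
same order, constants IDENTICAL; the room-free helper rows ✓`covLapSite_formComp_add_eq`, ✓`norm_equiv_remainder_le_of_letters`, ✓`nabla115_bgOfCfg_eq_covGradT`, … are IMPORTED, not copied).
* §1 ★★★ `norm_equiv_DL2_formComp_le_of_sup_allMembers` · ★★★ `norm_equiv_DL2_formComp_le_of_letters_allMembers` · ★★ `norm_covGradT_le_of_letters_allMembers` — (OF-GRAD) §1∕§2∕§3.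
* §2 ★★ `norm_covGrad_adBg_equiv_toL2_le_of_letters_allMembers` · ★★ `norm_nabla115_bgOfCfg_le_of_letters_allMembers` · `norm_nabla115_bgOfCfg_le_of_letters_allMembers'` — NABLA §2.
HYP-SAT (★★OWNER RULING №42).  Exactly (OF-GRAD)'s displayed letters minus the room: `RegPr` + `0 < ε₀ ≤ 1` (EX class); the one-form equation `hXY` (for `X := toL2⁻¹(G_T f)` it is
✓`laplaceA_GT`); `‖X‖_∞ ≤ s`, `‖Y‖_∞ ≤ M_Y`; the three O2-class bond letters (X)(D)(Q) (inhabited as recorded in (OF-GRAD)); `hsmall` = smallness of `ε₀` vs the universal `C_g`;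
conclusions non-vacuous; no `Prop` placeholder.
HONEST SCOPE.  Mechanical re-runs of landed proofs over (R3); nothing of T1-core, O1, `norm_G`, the EX rows, `hThm2S`, EX or the crux is proved here; the Yang–Mills mass gap is NOT proved.

References: T. Bałaban, CMP **102** (1985) 277–309 [Balaban1985Variational] ((19) p.281, (110)–(117) pp.294–295, (134)–(135) p.298); CMP **99** (1985) 389–434
[Balaban1985BackgroundPropagators] (Lemma 3.2 (3.45)–(3.48) pp.398–399, Thm 3.1 (3.42) p.397, p.399 L1–3); CMP **96** (1984) 223–250 [Balaban1984PropagatorsII] (Lemma 2.1 pp.227–228).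
-/

set_option autoImplicit false

noncomputable section

open scoped BigOperators Matrix.Norms.L2Operator InnerProductSpace ComplexConjugate

namespace Summit.QuantumFields.YangMills.Theorems.Prop7OneFormGradientSupAllMembers

open Literature.MathematicalPhysics.QuantumFieldTheory.Balaban1983to89
open Literature.MathematicalPhysics.QuantumFieldTheory.Balaban1983to89.T3ContinuumYM3Torus
open Literature.MathematicalPhysics.QuantumFieldTheory.Balaban1983to89.T3PrintedRegularMinimiser (RegPr)
open T3SectALandauChart (formComp covGradT bgUnits covDerivFwdT eta eta_pos)
open B4Sect5Torus (TSite)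
open B9SectCLatticeCarrier (Bond)
open B9TorusCalculus (torusT)
open B9Eq310Hermitian (deltaPrimeOp)
open B11Eq135Weitzenbock (curvOp)
open B9Eq311L2Pairing (WL2)
open B11Eq103H1Complex (SiteL2K BondL2K)
open Summit.QuantumFields.YangMills.Theorems.Prop7SectET3Transport (periodsT3 siteEquiv bondEquiv)
open Summit.QuantumFields.YangMills.Theorems.Prop7SectET3HilbertLetters (W₂ frobEquiv toL2 toL2S DL2 DstarL2 covLapSite toL2S_apply toL2_symm_apply)
open Summit.QuantumFields.YangMills.Theorems.Prop7SectET3WilsonHessian (DeltaEta)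
open Summit.QuantumFields.YangMills.Theorems.Prop7SectET3GaugeProjector (RS)
open Summit.QuantumFields.YangMills.Theorems.Prop7SectET3CurvedPropagators (Qk laplaceA)
open Summit.QuantumFields.YangMills.Theorems.Prop7RieszTauFrobNorm (norm_frobEquiv_le norm_frobEquiv_symm_le)
open Summit.QuantumFields.YangMills.Theorems.Prop7LandauDict (DL2_toL2S_eq_covDerivFwdT)
open Summit.QuantumFields.YangMills.Theorems.Prop7OneFormKatoForm (covLapSite_toL2S_formComp_eq norm_local_remainder_le_of_regPr)
open Summit.QuantumFields.YangMills.Theorems.Prop7CurvedMemberLocalGradient (exists_curved_localGradient)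
open Summit.QuantumFields.YangMills.Theorems.AxialGaugeChartGlue (norm_bgOfCfg_axialT_sub_le)
open B9Eq33CovDerivVector (covGrad covGrad_apply)
open B11Eq111FrakG (nabla115 nabla115_apply)
open Summit.QuantumFields.YangMills.Theorems.Prop7SectET3Transport (periodsT3 siteEquiv bondEquiv bgOfCfg)
open Summit.QuantumFields.YangMills.Theorems.Prop7SectET3HilbertLetters (W₂ frobEquiv adBg adW frobEquiv_adW toL2 toL2S DL2 DstarL2 covLapSite toL2_apply toL2S_apply toL2_symm_apply)
open Summit.QuantumFields.YangMills.Theorems.Prop7RieszTauFrobNorm (norm_frobEquiv_le)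
open Summit.QuantumFields.YangMills.Theorems.Prop7OneFormGradientSup (norm_equiv_DL2_formComp_le_of_letters norm_covGradT_le_of_letters)
open Summit.QuantumFields.YangMills.Theorems.Prop7MassiveSolutionGradientSupAllMembers (norm_equiv_DL2_le_of_sup_allMembers)
open Summit.QuantumFields.YangMills.Theorems.Prop7OneFormGradientSup (covLapSite_formComp_add_eq norm_equiv_toL2S_formComp_le norm_equiv_remainder_le_of_letters)
open Summit.QuantumFields.YangMills.Theorems.Prop7OneFormGradientSupNabla (frobEquiv_equiv_toL2 frobEquiv_covGrad_adBg_eq_nabla115 covGrad_adBg_equiv_toL2_eq nabla115_bgOfCfg_eq_covGradT)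

variable (F : T3Family) {n K : ℕ} (h : n ≤ K) (c₀ cB : ℝ) [Fact (0 < c₀)] [Fact (0 < cB)] (a : ℝ)
  (Δx : GaugeField (F.P K) 0 (Matrix.specialUnitaryGroup (Fin 2) ℂ) → (BondL2K ℂ 3 (periodsT3 F K) c₀ W₂ →ₗ[ℂ] BondL2K ℂ 3 (periodsT3 F K) c₀ W₂))
  (U₀ : GaugeField (F.P K) 0 (Matrix.specialUnitaryGroup (Fin 2) ℂ))
  {ε₀ : ℝ} (hε₀ : 0 < ε₀) (hε1 : ε₀ ≤ 1) (hreg : RegPr F n K ε₀ U₀)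

/-! ## §1 (OF-GRAD) at every member: T1 on bonds from the two global sup letters ∕ from the displayed letters ∕ the `covGradT` reading -/

include hε₀ hε1 hreg in
/-- ★★★ **T1 ON BONDS FROM THE TWO GLOBAL SUP LETTERS**: for `Δ_a(U₀)(toL2 X) = toL2 Y` with `‖(toL2S X_ν)(x)‖ ≤ M_u` and `‖q_ν(x)‖ ≤ M_q` for every component `ν` and lit-site `x`
(`q_ν` = O1's displayed remainder minus the source component), under `RegPr` and the margin (NO room — R3 ✓`norm_equiv_DL2_le_of_sup_allMembers`):
`‖(D_{U₀}(toL2S X_ν))(p)‖ ≤ 2·(C_g·(M_u·c(ε₀) + M_q) + 2√2·48ε₀·M_u)` at EVERY bond `p` and direction `ν` — R3 `norm_equiv_DL2_le_of_sup_allMembers` per component (px19's T1-core read on the `L³` cover).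
[cite: Balaban1985Variational, (19) p.281, (134)–(135) p.298; Balaban1985BackgroundPropagators, Lemma 3.2 (3.45)–(3.48) pp.398–399] -/
theorem norm_equiv_DL2_formComp_le_of_sup_allMembers (X Y : PBond (F.P K) 0 → Matrix (Fin 2) (Fin 2) ℂ)
    (hXY : laplaceA F n K h c₀ cB a Δx U₀ (toL2 F K c₀ X) = toL2 F K c₀ Y) {Mu Mq : ℝ} (hMu0 : 0 ≤ Mu) (hMq0 : 0 ≤ Mq)
    (hMu : ∀ (ν : Fin (F.P K).d) (x : TSite 3 (periodsT3 F K)), ‖WL2.equiv ℂ (fun _ : TSite 3 (periodsT3 F K) => c₀) W₂ (toL2S F K c₀ (formComp X ν)) x‖ ≤ Mu)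
    (hMq : ∀ (ν : Fin (F.P K).d) (x : TSite 3 (periodsT3 F K)), ‖WL2.equiv ℂ (fun _ : TSite 3 (periodsT3 F K) => c₀) W₂ (toL2S F K c₀ (fun x : Site (F.P K) 0 => (eta F n K)⁻¹ • (eta F n K)⁻¹ • (deltaPrimeOp (torusT (F.P K) 0) (fun μ x => bgUnits F K U₀ ⟨x, μ⟩) 1 (formComp X) ν x - curvOp (torusT (F.P K) 0) (fun μ x => bgUnits F K U₀ ⟨x, μ⟩) (formComp X) ν x) + (toL2 F K c₀).symm ((Δx U₀ - (DeltaEta F n K c₀ U₀ : BondL2K ℂ 3 (periodsT3 F K) c₀ W₂ →ₗ[ℂ] BondL2K ℂ 3 (periodsT3 F K) c₀ W₂)) (toL2 F K c₀ X)) ⟨x, ν⟩ - (toL2 F K c₀).symm (DL2 F n K c₀ U₀ (DstarL2 F n K c₀ U₀ (toL2 F K c₀ X) - RS F n K h c₀ cB U₀ (DstarL2 F n K c₀ U₀ (toL2 F K c₀ X)))) ⟨x, ν⟩ + (toL2 F K c₀).symm (LinearMap.adjoint (Qk F n K h c₀ cB U₀) (((a : ℝ) : ℂ) • Qk F n K h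 c₀ cB U₀ (toL2 F K c₀ X))) ⟨x, ν⟩) - toL2S F K c₀ (formComp Y ν)) x‖ ≤ Mq)
    (hsmall : exists_curved_localGradient.choose * ((48 * ε₀) * (6 * Real.sqrt 2 * Real.sqrt 10 + 6 * Real.sqrt 2)) ≤ 1 / 2)
    (ν : Fin (F.P K).d) (p : Bond 3 (periodsT3 F K)) :
    ‖WL2.equiv ℂ (fun _ : Bond 3 (periodsT3 F K) => c₀) W₂ (DL2 F n K c₀ U₀ (toL2S F K c₀ (formComp X ν))) p‖ ≤ 2 * (exists_curved_localGradient.choose * (Mu * (2 + 2 * Real.sqrt 2 * (4 * ε₀ * (3 + 2457 * norm_bgOfCfg_axialT_sub_le.choose)) + (24 * Real.sqrt 10 + 48) * (48 * ε₀) ^ 2) + Mq) + 2 * Real.sqrt 2 * (48 * ε₀) * Mu) :=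
  norm_equiv_DL2_le_of_sup_allMembers F n K hε₀ hε1 U₀ hreg c₀ _ _ (covLapSite_formComp_add_eq F h c₀ cB a Δx U₀ X Y hXY ν) hMu0 hMq0 (hMu ν) (hMq ν) hsmall p

include hε₀ hε1 hreg in
/-- ★★★ **T1 ON BONDS, LETTERS DISPLAYED**: for `Δ_a(U₀)(toL2 X) = toL2 Y` under `RegPr` (`0 < ε₀ ≤ 1`), with `‖X b‖ ≤ s`, `‖Y b‖ ≤ M_Y`, the three O2-class bond rows (X)(D)(Q), the room and the margin:
`‖(D_{U₀}(toL2S X_ν))(p)‖ ≤ 2·(C_g·(√2 s·c(ε₀) + √2(32ε₀ s + M_X + M_D + M_Q + M_Y)) + 2√2·48ε₀·√2 s)` at every bond and direction.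
[cite: Balaban1985Variational, (19) p.281, (134)–(135) p.298; Balaban1985BackgroundPropagators, Lemma 3.2 pp.398–399, Thm 3.1 (3.42) p.397] -/
theorem norm_equiv_DL2_formComp_le_of_letters_allMembers (X Y : PBond (F.P K) 0 → Matrix (Fin 2) (Fin 2) ℂ)
    (hXY : laplaceA F n K h c₀ cB a Δx U₀ (toL2 F K c₀ X) = toL2 F K c₀ Y)
    {s MY MX MD MQ : ℝ} (hs : 0 ≤ s) (hMY : 0 ≤ MY) (hMX : 0 ≤ MX) (hMD : 0 ≤ MD) (hMQ : 0 ≤ MQ)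
    (hX : ∀ b, ‖X b‖ ≤ s) (hY : ∀ b, ‖Y b‖ ≤ MY)
    (hXs : ∀ b : PBond (F.P K) 0, ‖(toL2 F K c₀).symm ((Δx U₀ - (DeltaEta F n K c₀ U₀ : BondL2K ℂ 3 (periodsT3 F K) c₀ W₂ →ₗ[ℂ] BondL2K ℂ 3 (periodsT3 F K) c₀ W₂)) (toL2 F K c₀ X)) b‖ ≤ MX)
    (hD : ∀ b : PBond (F.P K) 0, ‖(toL2 F K c₀).symm (DL2 F n K c₀ U₀ (DstarL2 F n K c₀ U₀ (toL2 F K c₀ X) - RS F n K h c₀ cB U₀ (DstarL2 F n K c₀ U₀ (toL2 F K c₀ X)))) b‖ ≤ MD)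
    (hQ : ∀ b : PBond (F.P K) 0, ‖(toL2 F K c₀).symm (LinearMap.adjoint (Qk F n K h c₀ cB U₀) (((a : ℝ) : ℂ) • Qk F n K h c₀ cB U₀ (toL2 F K c₀ X))) b‖ ≤ MQ)
    (hsmall : exists_curved_localGradient.choose * ((48 * ε₀) * (6 * Real.sqrt 2 * Real.sqrt 10 + 6 * Real.sqrt 2)) ≤ 1 / 2)
    (ν : Fin (F.P K).d) (p : Bond 3 (periodsT3 F K)) :
    ‖WL2.equiv ℂ (fun _ : Bond 3 (periodsT3 F K) => c₀) W₂ (DL2 F n K c₀ U₀ (toL2S F K c₀ (formComp X ν))) p‖ ≤ 2 * (exists_curved_localGradient.choose * ((Real.sqrt 2 * s) * (2 + 2 * Real.sqrt 2 * (4 * ε₀ * (3 + 2457 * norm_bgOfCfg_axialT_sub_le.choose)) + (24 * Real.sqrt 10 + 48) * (48 * ε₀) ^ 2) + (Real.sqrt 2 * (32 * ε₀ * s + MX + MD + MQ + MY))) + 2 * Real.sqrt 2 * (48 * ε₀) * (Real.sqrt 2 * s)) := by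
  have hMu0 : 0 ≤ Real.sqrt 2 * s := by positivity
  have hMq0 : 0 ≤ Real.sqrt 2 * (32 * ε₀ * s + MX + MD + MQ + MY) := by positivity
  exact norm_equiv_DL2_formComp_le_of_sup_allMembers F h c₀ cB a Δx U₀ hε₀ hε1 hreg X Y hXY hMu0 hMq0
    (fun ν x => norm_equiv_toL2S_formComp_le F c₀ X hX ν x)
    (fun ν x => norm_equiv_remainder_le_of_letters F h c₀ cB a Δx U₀ hreg X Y hX hY hXs hD hQ ν x) hsmall ν p

include hε₀ hε1 hreg in
/-- ★★ **THE COVARIANT GRADIENT OF THE ONE-FORM IN SUP** — `‖(D^η_{U₀,μ} X_ν)(x)‖ = ‖covGradT (eta F n K) (bgUnits F K U₀) X μ ν x‖ ≤` the §2 bound, for every `μ ν x` (the dictionary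
✓`DL2_toL2S_eq_covDerivFwdT` + operator norm ≤ Frobenius norm ✓`norm_frobEquiv_le`): the `∇^η_{U₀}`-half of print's `|𝔊f|₍₁₎` from VALUE-class letters.
[cite: Balaban1985Variational, (19) p.281, (115)–(117) pp.294–295; Balaban1985BackgroundPropagators, Thm 3.1 (3.42) p.397] -/
theorem norm_covGradT_le_of_letters_allMembers (X Y : PBond (F.P K) 0 → Matrix (Fin 2) (Fin 2) ℂ)
    (hXY : laplaceA F n K h c₀ cB a Δx U₀ (toL2 F K c₀ X) = toL2 F K c₀ Y)
    {s MY MX MD MQ : ℝ} (hs : 0 ≤ s) (hMY : 0 ≤ MY) (hMX : 0 ≤ MX) (hMD : 0 ≤ MD) (hMQ : 0 ≤ MQ)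
    (hX : ∀ b, ‖X b‖ ≤ s) (hY : ∀ b, ‖Y b‖ ≤ MY)
    (hXs : ∀ b : PBond (F.P K) 0, ‖(toL2 F K c₀).symm ((Δx U₀ - (DeltaEta F n K c₀ U₀ : BondL2K ℂ 3 (periodsT3 F K) c₀ W₂ →ₗ[ℂ] BondL2K ℂ 3 (periodsT3 F K) c₀ W₂)) (toL2 F K c₀ X)) b‖ ≤ MX)
    (hD : ∀ b : PBond (F.P K) 0, ‖(toL2 F K c₀).symm (DL2 F n K c₀ U₀ (DstarL2 F n K c₀ U₀ (toL2 F K c₀ X) - RS F n K h c₀ cB U₀ (DstarL2 F n K c₀ U₀ (toL2 F K c₀ X)))) b‖ ≤ MD)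
    (hQ : ∀ b : PBond (F.P K) 0, ‖(toL2 F K c₀).symm (LinearMap.adjoint (Qk F n K h c₀ cB U₀) (((a : ℝ) : ℂ) • Qk F n K h c₀ cB U₀ (toL2 F K c₀ X))) b‖ ≤ MQ)
    (hsmall : exists_curved_localGradient.choose * ((48 * ε₀) * (6 * Real.sqrt 2 * Real.sqrt 10 + 6 * Real.sqrt 2)) ≤ 1 / 2)
    (μ ν : Fin (F.P K).d) (x : Site (F.P K) 0) :
    ‖covGradT (eta F n K) (bgUnits F K U₀) X μ ν x‖ ≤ 2 * (exists_curved_localGradient.choose * ((Real.sqrt 2 * s) * (2 + 2 * Real.sqrt 2 * (4 * ε₀ * (3 + 2457 * norm_bgOfCfg_axialT_sub_le.choose)) + (24 * Real.sqrt 10 + 48) * (48 * ε₀) ^ 2) + (Real.sqrt 2 * (32 * ε₀ * s + MX + MD + MQ + MY))) + 2 * Real.sqrt 2 * (48 * ε₀) * (Real.sqrt 2 * s)) := by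
  have hdict : covGradT (eta F n K) (bgUnits F K U₀) X μ ν x = (toL2 F K c₀).symm (DL2 F n K c₀ U₀ (toL2S F K c₀ (formComp X ν))) ⟨x, μ⟩ := by
    rw [DL2_toL2S_eq_covDerivFwdT]; rfl
  rw [hdict, toL2_symm_apply]
  exact (norm_frobEquiv_le _).trans
    (norm_equiv_DL2_formComp_le_of_letters_allMembers F h c₀ cB a Δx U₀ hε₀ hε1 hreg X Y hXY hs hMY hMX hMD hMQ hX hY hXs hD hQ hsmall ν _)

/-! ## §2 (OF-GRAD)∕NABLA at every member: the (∇) letters in the `W₂`, `nabla115` and pointwise currencies -/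

include hε₀ hε1 hreg in
/-- ★★ **THE W-LEVEL (∇) LETTER** (the `hDT` currency of lit ✓`norm_nabla115_readFun_le_of_global`): for `Δ_a(U₀)(toL2 X) = toL2 Y` with (OF-GRAD)'s letters, at EVERY lit bond `p`
and component `ν`, `‖(covGrad ((η:ℂ))⁻¹ (adBg U₀) (equiv (toL2 X))) (p, ν)‖ ≤ 2·(C_g·(√2 s·c(ε₀) + √2(32ε₀ s + M_X + M_D + M_Q + M_Y)) + 2√2·48ε₀·√2 s)`.
[cite: Balaban1985BackgroundPropagators, (3.3) p.391, Thm 3.1 (3.42) p.397; Balaban1985Variational, (19) p.281] -/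
theorem norm_covGrad_adBg_equiv_toL2_le_of_letters_allMembers (X Y : PBond (F.P K) 0 → Matrix (Fin 2) (Fin 2) ℂ)
    (hXY : laplaceA F n K h c₀ cB a Δx U₀ (toL2 F K c₀ X) = toL2 F K c₀ Y)
    {s MY MX MD MQ : ℝ} (hs : 0 ≤ s) (hMY : 0 ≤ MY) (hMX : 0 ≤ MX) (hMD : 0 ≤ MD) (hMQ : 0 ≤ MQ)
    (hX : ∀ b, ‖X b‖ ≤ s) (hY : ∀ b, ‖Y b‖ ≤ MY)
    (hXs : ∀ b : PBond (F.P K) 0, ‖(toL2 F K c₀).symm ((Δx U₀ - (DeltaEta F n K c₀ U₀ : BondL2K ℂ 3 (periodsT3 F K) c₀ W₂ →ₗ[ℂ] BondL2K ℂ 3 (periodsT3 F K) c₀ W₂)) (toL2 F K c₀ X)) b‖ ≤ MX)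
    (hD : ∀ b : PBond (F.P K) 0, ‖(toL2 F K c₀).symm (DL2 F n K c₀ U₀ (DstarL2 F n K c₀ U₀ (toL2 F K c₀ X) - RS F n K h c₀ cB U₀ (DstarL2 F n K c₀ U₀ (toL2 F K c₀ X)))) b‖ ≤ MD)
    (hQ : ∀ b : PBond (F.P K) 0, ‖(toL2 F K c₀).symm (LinearMap.adjoint (Qk F n K h c₀ cB U₀) (((a : ℝ) : ℂ) • Qk F n K h c₀ cB U₀ (toL2 F K c₀ X))) b‖ ≤ MQ)
    (hsmall : exists_curved_localGradient.choose * ((48 * ε₀) * (6 * Real.sqrt 2 * Real.sqrt 10 + 6 * Real.sqrt 2)) ≤ 1 / 2)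
    (p : Bond 3 (periodsT3 F K)) (ν : Fin 3) :
    ‖covGrad ((((eta F n K : ℝ) : ℂ))⁻¹) (adBg F K U₀) (WL2.equiv ℂ (fun _ : Bond 3 (periodsT3 F K) => c₀) W₂ (toL2 F K c₀ X)) (p, ν)‖ ≤ 2 * (exists_curved_localGradient.choose * ((Real.sqrt 2 * s) * (2 + 2 * Real.sqrt 2 * (4 * ε₀ * (3 + 2457 * norm_bgOfCfg_axialT_sub_le.choose)) + (24 * Real.sqrt 10 + 48) * (48 * ε₀) ^ 2) + (Real.sqrt 2 * (32 * ε₀ * s + MX + MD + MQ + MY))) + 2 * Real.sqrt 2 * (48 * ε₀) * (Real.sqrt 2 * s)) := by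
  rw [covGrad_adBg_equiv_toL2_eq]
  exact norm_equiv_DL2_formComp_le_of_letters_allMembers F h c₀ cB a Δx U₀ hε₀ hε1 hreg X Y hXY hs hMY hMX hMD hMQ hX hY hXs hD hQ hsmall ν p

include hε₀ hε1 hreg in
/-- ★★★ **THE (115)-LEVEL (∇) LETTER IN THE SUP NORM**: `‖nabla115 (eta F n K) (bgOfCfg F K U₀) (X ∘ bondEquiv⁻¹)‖ ≤ B` (the Pi sup norm over `Bond × Fin 3` of the operator norms — the `∇`-half
of print's `|·|₍₁₎` at a member, where all (115) weights are `1`). [cite: Balaban1985Variational, (19) p.281, (115)–(117) pp.294–295; Balaban1985BackgroundPropagators, Thm 3.1 (3.42) p.397] -/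
theorem norm_nabla115_bgOfCfg_le_of_letters_allMembers (X Y : PBond (F.P K) 0 → Matrix (Fin 2) (Fin 2) ℂ)
    (hXY : laplaceA F n K h c₀ cB a Δx U₀ (toL2 F K c₀ X) = toL2 F K c₀ Y)
    {s MY MX MD MQ : ℝ} (hs : 0 ≤ s) (hMY : 0 ≤ MY) (hMX : 0 ≤ MX) (hMD : 0 ≤ MD) (hMQ : 0 ≤ MQ)
    (hX : ∀ b, ‖X b‖ ≤ s) (hY : ∀ b, ‖Y b‖ ≤ MY)
    (hXs : ∀ b : PBond (F.P K) 0, ‖(toL2 F K c₀).symm ((Δx U₀ - (DeltaEta F n K c₀ U₀ : BondL2K ℂ 3 (periodsT3 F K) c₀ W₂ →ₗ[ℂ] BondL2K ℂ 3 (periodsT3 F K) c₀ W₂)) (toL2 F K c₀ X)) b‖ ≤ MX)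
    (hD : ∀ b : PBond (F.P K) 0, ‖(toL2 F K c₀).symm (DL2 F n K c₀ U₀ (DstarL2 F n K c₀ U₀ (toL2 F K c₀ X) - RS F n K h c₀ cB U₀ (DstarL2 F n K c₀ U₀ (toL2 F K c₀ X)))) b‖ ≤ MD)
    (hQ : ∀ b : PBond (F.P K) 0, ‖(toL2 F K c₀).symm (LinearMap.adjoint (Qk F n K h c₀ cB U₀) (((a : ℝ) : ℂ) • Qk F n K h c₀ cB U₀ (toL2 F K c₀ X))) b‖ ≤ MQ)
    (hsmall : exists_curved_localGradient.choose * ((48 * ε₀) * (6 * Real.sqrt 2 * Real.sqrt 10 + 6 * Real.sqrt 2)) ≤ 1 / 2) :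
    ‖nabla115 (eta F n K) (bgOfCfg F K U₀) (fun q => X ((bondEquiv F K).symm q))‖ ≤ 2 * (exists_curved_localGradient.choose * ((Real.sqrt 2 * s) * (2 + 2 * Real.sqrt 2 * (4 * ε₀ * (3 + 2457 * norm_bgOfCfg_axialT_sub_le.choose)) + (24 * Real.sqrt 10 + 48) * (48 * ε₀) ^ 2) + (Real.sqrt 2 * (32 * ε₀ * s + MX + MD + MQ + MY))) + 2 * Real.sqrt 2 * (48 * ε₀) * (Real.sqrt 2 * s)) := by
  have hCg0 : 0 ≤ exists_curved_localGradient.choose := exists_curved_localGradient.choose_spec.1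
  obtain ⟨hC0, -⟩ := norm_bgOfCfg_axialT_sub_le.choose_spec
  have hB : 0 ≤ 2 * (exists_curved_localGradient.choose * ((Real.sqrt 2 * s) * (2 + 2 * Real.sqrt 2 * (4 * ε₀ * (3 + 2457 * norm_bgOfCfg_axialT_sub_le.choose)) + (24 * Real.sqrt 10 + 48) * (48 * ε₀) ^ 2) + (Real.sqrt 2 * (32 * ε₀ * s + MX + MD + MQ + MY))) + 2 * Real.sqrt 2 * (48 * ε₀) * (Real.sqrt 2 * s)) := by positivity
  refine (pi_norm_le_iff_of_nonneg hB).2 fun qν => ?_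
  obtain ⟨q, ν⟩ := qν
  obtain ⟨b, rfl⟩ := (bondEquiv F K).surjective q
  obtain ⟨x, μ⟩ := b
  rw [nabla115_bgOfCfg_eq_covGradT F c₀ U₀]
  exact norm_covGradT_le_of_letters_allMembers F h c₀ cB a Δx U₀ hε₀ hε1 hreg X Y hXY hs hMY hMX hMD hMQ hX hY hXs hD hQ hsmall μ ν x

include hε₀ hε1 hreg in
/-- The same letter with `η` spelled `((F.L:ℝ)⁻¹)^(K−n)` (the EX face's spelling of `nabla115`'s scale; `eta F n K` is that term by definition). [cite: Balaban1985Variational, (5) p.278, (115) p.294] -/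
theorem norm_nabla115_bgOfCfg_le_of_letters_allMembers' (X Y : PBond (F.P K) 0 → Matrix (Fin 2) (Fin 2) ℂ)
    (hXY : laplaceA F n K h c₀ cB a Δx U₀ (toL2 F K c₀ X) = toL2 F K c₀ Y)
    {s MY MX MD MQ : ℝ} (hs : 0 ≤ s) (hMY : 0 ≤ MY) (hMX : 0 ≤ MX) (hMD : 0 ≤ MD) (hMQ : 0 ≤ MQ)
    (hX : ∀ b, ‖X b‖ ≤ s) (hY : ∀ b, ‖Y b‖ ≤ MY)
    (hXs : ∀ b : PBond (F.P K) 0, ‖(toL2 F K c₀).symm ((Δx U₀ - (DeltaEta F n K c₀ U₀ : BondL2K ℂ 3 (periodsT3 F K) c₀ W₂ →ₗ[ℂ] BondL2K ℂ 3 (periodsT3 F K) c₀ W₂)) (toL2 F K c₀ X)) b‖ ≤ MX)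
    (hD : ∀ b : PBond (F.P K) 0, ‖(toL2 F K c₀).symm (DL2 F n K c₀ U₀ (DstarL2 F n K c₀ U₀ (toL2 F K c₀ X) - RS F n K h c₀ cB U₀ (DstarL2 F n K c₀ U₀ (toL2 F K c₀ X)))) b‖ ≤ MD)
    (hQ : ∀ b : PBond (F.P K) 0, ‖(toL2 F K c₀).symm (LinearMap.adjoint (Qk F n K h c₀ cB U₀) (((a : ℝ) : ℂ) • Qk F n K h c₀ cB U₀ (toL2 F K c₀ X))) b‖ ≤ MQ)
    (hsmall : exists_curved_localGradient.choose * ((48 * ε₀) * (6 * Real.sqrt 2 * Real.sqrt 10 + 6 * Real.sqrt 2)) ≤ 1 / 2) :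
    ‖nabla115 (((F.L : ℝ)⁻¹) ^ (K - n)) (bgOfCfg F K U₀) (fun q => X ((bondEquiv F K).symm q))‖ ≤ 2 * (exists_curved_localGradient.choose * ((Real.sqrt 2 * s) * (2 + 2 * Real.sqrt 2 * (4 * ε₀ * (3 + 2457 * norm_bgOfCfg_axialT_sub_le.choose)) + (24 * Real.sqrt 10 + 48) * (48 * ε₀) ^ 2) + (Real.sqrt 2 * (32 * ε₀ * s + MX + MD + MQ + MY))) + 2 * Real.sqrt 2 * (48 * ε₀) * (Real.sqrt 2 * s)) :=
  norm_nabla115_bgOfCfg_le_of_letters_allMembers F h c₀ cB a Δx U₀ hε₀ hε1 hreg X Y hXY hs hMY hMX hMD hMQ hX hY hXs hD hQ hsmall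

end Summit.QuantumFields.YangMills.Theorems.Prop7OneFormGradientSupAllMembers

end
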